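import Literature.Analysis.FluidPDE.ForwardDSSCylinderLimit
import Literature.Analysis.FluidPDE.SuitableWeakCongr
import HarnessLib

/-!
# Forward DSS solutions: the compactness fact on the unit cylinder split into its two parts

Analysis/FluidPDE fact-and-proof file over `ForwardDSSCylinderLimit.lean`, whose named fact
`bradshawTsai2019_cylinderLimit` is the DSS-free analytic core of the limit step of Bradshaw–Tsai,
Analysis & PDE 12 (2019) = arXiv:1801.08060, §4.3 (p. 12). That core still consists of two
statements of a different kind, printed as two sentences:

1. **interior compactness and stability of suitable weak solutions on the cylinder**
   `W = (0,T) × B₁` — "As usual (cf. [BT1, KiSe, LR2]), there exists a distribution `v` and a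
   subsequence … so that `vₖ` converges to `v` … in `L²(0,T;L²(B₁))` … `πₖ` … converges weakly to
   … `π ∈ L^{3/2}(0,T;L^{3/2}(B₁))` … The local energy inequality for `v` plainly follows" — a
   statement about suitable weak solutions on `W` with uniform `L^∞L² ∩ L²H¹` (velocity) and
   `L^{3/2}` (pressure) bounds only, with no reference to data or to anything outside `W`
   (the classical compactness of suitable weak solutions, Lin 1998, Thm 2.2; Albritton–Barker
   2019, Lemma 2.2 = the tree's `SuitableCompactness` on backward parabolic balls);
2. **continuity of the limit at `t = 0` in local `L²`** — "For compact subsets `K` of `B₁`, we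
   automatically have `lim_{t→0⁺} ‖v − v₀‖_{L²(K)} = 0`" — which uses that the `vₖ` are local
   Leray solutions with data `w₀⁽ᵏ⁾ → v₀` in `L²(B₁)` (the local energy inequality up to `t = 0`
   and the uniform weak equicontinuity at `t = 0`; Lemarié-Rieusset, *The Navier–Stokes problem
   in the 21st century*, Prop. 14.1).

This file vendors the two as the named facts `bradshawTsai2019_cylinderCompactness` and
`bradshawTsai2019_limitDatum` and **proves**
`bradshawTsai2019_cylinderLimit_of_parts :
  bradshawTsai2019_cylinderCompactness → bradshawTsai2019_limitDatum →
  bradshawTsai2019_cylinderLimit`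
(restrict the local Leray solutions to `W`, apply 1., re-choose the limit velocity within its
class by 2. — all clauses of 1. are invariant under a.e. modification on `W`,
`IsSuitableWeakSolutionOn.congr_ae`). The trust base of Theorem 1.2 in the tree thereby becomes
Lemma 4.1, Prop. 3.1 (dss), interior compactness (1.) and the datum continuity (2.).

## Design notes

* In 1. the solutions are only assumed suitable on the open cylinder `timeCylinder unitBall 0 T`
  with the three bounds there (the weak spatial gradient is one on the cylinder); nothing up to
  `t = 0`, nothing outside `B₁`. The strong convergence is asserted in `L²` of the whole cylinder
  (as printed: `L²(0,T;L²(B₁))`): interior Rellich–Lions compactness together with the uniform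
  `L^{10/3}(W)` bound furnished by the hypotheses (multiplicative inequality on the ball) gives
  it. The limit is a suitable weak solution on the open cylinder with the same bounds (lower
  semicontinuity), and the pressures converge weakly in `L^{3/2}(W)` (tested against `L³(W)`).
* In 2. the limit enters only through its class: any measurable `u` on `W` with `v_{σ(j)} → u`
  in `L²(W)` along some subsequence has a representative `ũ = u` a.e. on `W` attaining `v₀` in
  `L²(K)` for every compact `K ⊆ B₁` and every `t → 0⁺` (the a.e.-in-time statement of the
  printed argument, upgraded by re-defining the slices on a null set of times). The hypotheses on
  the sequence are those of `bradshawTsai2019_cylinderLimit` verbatim.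

## References

* Z. Bradshaw, T.-P. Tsai, Analysis & PDE 12 (2019) = arXiv:1801.08060, §4.3 (proof of Thm 1.2,
  p. 12) [BradshawTsai2019].
* F. Lin, *A new proof of the Caffarelli–Kohn–Nirenberg theorem*, CPAM 51 (1998), Thm 2.2
  [Lin1998]; D. Albritton, T. Barker, J. Math. Fluid Mech. 21 (2019), Lemma 2.2
  [AlbrittonBarker2019] (compactness of suitable weak solutions).
* P. G. Lemarié-Rieusset, *The Navier–Stokes problem in the 21st century*, 2nd ed. (2023),
  Thm 12.1 (Rellich–Lions), Thm 6.2, Prop. 14.1 [Lemarierieusset2023].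
-/

noncomputable section

open MeasureTheory TopologicalSpace Set Function Filter Metric
open scoped NNReal ENNReal Topology

namespace Literature.Analysis.FluidPDE

/-- Local notation for physical space `ℝ³ = EuclideanSpace ℝ (Fin 3)`. -/
local notation "ℝ³" => EuclideanSpace ℝ (Fin 3)

/-! ## The two parts -/

/-- **Compactness and stability of suitable weak solutions on the unit cylinder** (Bradshaw–Tsai
2019, §4.3, arXiv p. 12: "`vₖ` are uniformly bounded in `L^∞(0,T;L²(B₁)) ∩ L²(0,T;H¹(B₁))` … As
usual (cf. [BT1, KiSe, LR2]), there exists a distribution `v` and a subsequence … so that `vₖ`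
converges to `v` in the weak star topology on `L^∞(0,T;L²(B₁))`, in the weak topology on
`L²(0,T;H¹(B₁))`, and in `L²(0,T;L²(B₁))` … `πₖ` are uniformly bounded in
`L^{3/2}(0,T;L^{3/2}(B₁))` … we may extract a subsequence which converges weakly to a
distribution `π ∈ L^{3/2}(0,T;L^{3/2}(B₁))` … each `vₖ` satisfies the local energy inequality …
the right hand sides … converge … while the left hand-sides are lower semi-continuous (cf. [CKN]).
The local energy inequality for `v` plainly follows"; the classical compactness of suitable weak
solutions: Lin 1998, Thm 2.2; Albritton–Barker 2019, Lemma 2.2). Rendered for suitable weak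
solutions `(vₖ, πₖ)` (viscosity `1`, no force) on the open cylinder `W = (0,T) × B₁` with, for
some `C`, `esssup_{0<t<T} ∫_{B₁}|vₖ(t)|² ≤ C`, `∫∫_W |∇vₖ|² ≤ C` (a weak spatial gradient on `W`)
and `∫∫_W |πₖ|^{3/2} ≤ C` uniformly in `k`: there are a subsequence `σ` and a pair `(u, p)` which
is a suitable weak solution on `W` with the same three bounds, `v_{σ(j)} → u` in `L²(W)` and
`π_{σ(j)} ⇀ p` weakly in `L^{3/2}(W)` (tested against `L³(W)`). The weak-star/weak convergences
of the velocities are omitted from the conclusion (module docstring). [cite: BradshawTsai2019, §4.3 (proof of Thm 1.2, arXiv p. 12) "As usual …" and "The local energy inequality for v plainly follows"; classical form Lin1998 Thm 2.2, AlbrittonBarker2019 Lemma 2.2] -/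
def bradshawTsai2019_cylinderCompactness : Prop :=
  ∀ {v : ℕ → ℝ → ℝ³ → ℝ³} {π : ℕ → ℝ → ℝ³ → ℝ} {T : ℝ} {C : ℝ≥0},
    (∀ k, IsSuitableWeakSolutionOn (timeCylinder unitBall 0 T) 1 0 (v k) (π k)) →
    0 < T →
    (∀ k, ∀ᵐ t ∂(volume.restrict (Ioo 0 T)), ∫⁻ x in ball (0 : ℝ³) 1, ‖v k t x‖ₑ ^ 2 ≤ C) →
    (∀ k, ∃ G : ℝ → ℝ³ → ℝ³ →L[ℝ] ℝ³,
      HasWeakSpatialGradientOn (timeCylinder unitBall 0 T) (v k) G ∧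
      ∫⁻ z in Ioo 0 T ×ˢ ball (0 : ℝ³) 1, ENNReal.ofReal (frobeniusNormSq (G z.1 z.2)) ≤ C) →
    (∀ k, ∫⁻ z in Ioo 0 T ×ˢ ball (0 : ℝ³) 1, ‖π k z.1 z.2‖ₑ ^ (3 / 2 : ℝ) ≤ C) →
    ∃ (σ : ℕ → ℕ) (u : ℝ → ℝ³ → ℝ³) (p : ℝ → ℝ³ → ℝ), StrictMono σ ∧
      IsSuitableWeakSolutionOn (timeCylinder unitBall 0 T) 1 0 u p ∧
      (∀ᵐ t ∂(volume.restrict (Ioo 0 T)), ∫⁻ x in ball (0 : ℝ³) 1, ‖u t x‖ₑ ^ 2 ≤ C) ∧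
      (∃ G : ℝ → ℝ³ → ℝ³ →L[ℝ] ℝ³, HasWeakSpatialGradientOn (timeCylinder unitBall 0 T) u G ∧
        ∫⁻ z in Ioo 0 T ×ˢ ball (0 : ℝ³) 1, ENNReal.ofReal (frobeniusNormSq (G z.1 z.2)) ≤ C) ∧
      ∫⁻ z in Ioo 0 T ×ˢ ball (0 : ℝ³) 1, ‖p z.1 z.2‖ₑ ^ (3 / 2 : ℝ) ≤ C ∧
      Tendsto (fun j => ∫⁻ z in Ioo 0 T ×ˢ ball (0 : ℝ³) 1, ‖v (σ j) z.1 z.2 - u z.1 z.2‖ₑ ^ 2)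
        atTop (𝓝 0) ∧
      (∀ g : ℝ × ℝ³ → ℝ, MemLp g 3 (volume.restrict (Ioo 0 T ×ˢ ball (0 : ℝ³) 1)) →
        Tendsto (fun j => ∫ z in Ioo 0 T ×ˢ ball (0 : ℝ³) 1, π (σ j) z.1 z.2 * g z) atTop
          (𝓝 (∫ z in Ioo 0 T ×ˢ ball (0 : ℝ³) 1, p z.1 z.2 * g z)))

/-- **Continuity of the limit at `t = 0` in local `L²`** (Bradshaw–Tsai 2019, §4.3, arXiv p. 12:
"For compact subsets `K` of `B₁`, we automatically have `lim_{t→0⁺} ‖v − v₀‖_{L²(K)} = 0`"; the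
printed argument is Lemarié-Rieusset's Prop. 14.1: weak equicontinuity at `t = 0` from the
equations and `limsup_{t→0⁺} ∫|v(t)|²φ ≤ ∫|v₀|²φ` from the local energy inequality up to
`t = 0`, both uniformly along the approximating local Leray solutions). Rendered at the level of
the limit *class*: for local Leray solutions `(vₖ, πₖ)` with measurable data `w₀⁽ᵏ⁾ → v₀` in
`L²(B₁)` (`v₀ ∈ L²_loc` measurable) obeying the three bounds of `bradshawTsai2019_cylinderLimit`
on `W = (0,T) × B₁` uniformly in `k`, every measurable `u` on `W` with `v_{σ(j)} → u` in `L²(W)`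
along some subsequence `σ` has a representative `ũ` (`ũ = u` a.e. on `W`) with
`∫_K |ũ(t) − v₀|² → 0` as `t → 0⁺` for every compact `K ⊆ B₁` (every `t`, as in
`IsLocalLeraySolution.initial`). [cite: BradshawTsai2019, §4.3 (proof of Thm 1.2, arXiv p. 12) "For compact subsets K of B₁, we automatically have …"; argument of Lemarierieusset2023 Prop 14.1] -/
def bradshawTsai2019_limitDatum : Prop :=
  ∀ {v₀ : ℝ³ → ℝ³}, AEStronglyMeasurable v₀ volume →
    LocallyIntegrable (fun x => ‖v₀ x‖ ^ 2) volume →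
    ∀ {w₀ : ℕ → ℝ³ → ℝ³} {v : ℕ → ℝ → ℝ³ → ℝ³} {π : ℕ → ℝ → ℝ³ → ℝ} {T : ℝ} {C : ℝ≥0},
    (∀ k, AEStronglyMeasurable (w₀ k) volume) →
    Tendsto (fun k => ∫⁻ x in ball (0 : ℝ³) 1, ‖w₀ k x - v₀ x‖ₑ ^ 2) atTop (𝓝 0) →
    (∀ k, IsLocalLeraySolution 1 (w₀ k) (v k) (π k)) →
    0 < T →
    (∀ k, ∀ᵐ t ∂(volume.restrict (Ioo 0 T)), ∫⁻ x in ball (0 : ℝ³) 1, ‖v k t x‖ₑ ^ 2 ≤ C) →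
    (∀ k, ∃ G : ℝ → ℝ³ → ℝ³ →L[ℝ] ℝ³,
      HasWeakSpatialGradientOn (slab ℝ³ (Ioi 0) isOpen_Ioi) (v k) G ∧
      ∫⁻ z in Ioo 0 T ×ˢ ball (0 : ℝ³) 1, ENNReal.ofReal (frobeniusNormSq (G z.1 z.2)) ≤ C) →
    (∀ k, ∫⁻ z in Ioo 0 T ×ˢ ball (0 : ℝ³) 1, ‖π k z.1 z.2‖ₑ ^ (3 / 2 : ℝ) ≤ C) →
    ∀ {σ : ℕ → ℕ} {u : ℝ → ℝ³ → ℝ³}, StrictMono σ →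
      AEStronglyMeasurable (uncurry u) (volume.restrict (Ioo 0 T ×ˢ ball (0 : ℝ³) 1)) →
      Tendsto (fun j => ∫⁻ z in Ioo 0 T ×ˢ ball (0 : ℝ³) 1, ‖v (σ j) z.1 z.2 - u z.1 z.2‖ₑ ^ 2)
        atTop (𝓝 0) →
      ∃ u' : ℝ → ℝ³ → ℝ³,
        (∀ᵐ z ∂(volume.restrict (Ioo 0 T ×ˢ ball (0 : ℝ³) 1)), uncurry u' z = uncurry u z) ∧
        ∀ K : Set ℝ³, IsCompact K → K ⊆ ball 0 1 →
          Tendsto (fun t => ∫⁻ x in K, ‖u' t x - v₀ x‖ₑ ^ 2) (𝓝[>] 0) (𝓝 0)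

/-! ## The compactness fact from its two parts -/

/-- **`bradshawTsai2019_cylinderLimit` from interior compactness and the datum continuity.**
Restrict the local Leray solutions to the open cylinder (`IsSuitableWeakSolutionOn.of_le`,
`HasWeakSpatialGradientOn.mono`), extract the limit `(u, p)` by
`bradshawTsai2019_cylinderCompactness`, and replace `u` by the representative `ũ` of
`bradshawTsai2019_limitDatum`; suitability, the energy bound (slice-wise a.e.), the weak
gradient and the strong convergence are invariant under this a.e. modification on the cylinder
(`IsSuitableWeakSolutionOn.congr_ae`, `HasWeakSpatialGradientOn.congr_ae`). [cite: BradshawTsai2019, §4.3 (proof of Thm 1.2)] -/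
theorem bradshawTsai2019_cylinderLimit_of_parts (hC : bradshawTsai2019_cylinderCompactness)
    (hD : bradshawTsai2019_limitDatum) : bradshawTsai2019_cylinderLimit := by
  intro v₀ hm₀ hL2 w₀ v π T C hw hconv hLL hT hE hG hP
  -- restriction to the open cylinder
  have hle : (timeCylinder unitBall 0 T : Opens (ℝ × ℝ³)) ≤ slab ℝ³ (Ioi 0) isOpen_Ioi :=
    fun z hz => mem_slab.2 hz.1.1
  have hsuitk : ∀ k, IsSuitableWeakSolutionOn (timeCylinder unitBall 0 T) 1 0 (v k) (π k) :=
    fun k => (hLL k).suitable.of_le hle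
  have hGk : ∀ k, ∃ G : ℝ → ℝ³ → ℝ³ →L[ℝ] ℝ³,
      HasWeakSpatialGradientOn (timeCylinder unitBall 0 T) (v k) G ∧
      ∫⁻ z in Ioo 0 T ×ˢ ball (0 : ℝ³) 1, ENNReal.ofReal (frobeniusNormSq (G z.1 z.2)) ≤ C :=
    fun k => (hG k).imp fun G hG' => ⟨hG'.1.mono hle, hG'.2⟩
  obtain ⟨σ, u, p, hσ, hsuit, hen, ⟨G₀, hG₀, hG₀b⟩, hpb, hstrong, hweak⟩ := hC hsuitk hT hE hGk hP
  -- the datum representative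
  set W : Set (ℝ × ℝ³) := Ioo (0 : ℝ) T ×ˢ ball (0 : ℝ³) 1 with hWdef
  have hWm : MeasurableSet W := measurableSet_Ioo.prod measurableSet_ball
  have hum : AEStronglyMeasurable (uncurry u) (volume.restrict W) :=
    hsuit.distributional.1.aestronglyMeasurable
  obtain ⟨u', hu', hdatum⟩ := hD hm₀ hL2 hw hconv hLL hT hE hG hP hσ hum hstrong
  have hu'symm : ∀ᵐ z ∂(volume.restrict W), uncurry u z = uncurry u' z := by
    filter_upwards [hu'] with z hz using hz.symm
  have hp : ∀ᵐ z ∂(volume.restrict W), uncurry p z = uncurry p z := Eventually.of_forall fun _ => rfl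
  refine ⟨σ, u', p, hσ, hsuit.congr_ae hu'symm hp, ?_, ⟨G₀, hG₀.congr_ae hu'symm, hG₀b⟩, hpb, ?_,
    hweak, hdatum⟩
  · -- the energy bound, slice-wise
    have hprod : ∀ᵐ z : ℝ × ℝ³ ∂(volume : Measure ℝ).prod (volume : Measure ℝ³),
        z ∈ W → uncurry u' z = uncurry u z := by
      rw [← Measure.volume_eq_prod]
      exact ae_imp_of_ae_restrict hu'
    have h2 := Measure.ae_ae_of_ae_prod (p := fun z : ℝ × ℝ³ => z ∈ W → uncurry u' z = uncurry u z)
      hprod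
    filter_upwards [hen, ae_restrict_of_ae (s := Ioo (0 : ℝ) T) h2,
      ae_restrict_mem measurableSet_Ioo] with t ht ht' htI
    calc ∫⁻ x in ball (0 : ℝ³) 1, ‖u' t x‖ₑ ^ 2 = ∫⁻ x in ball (0 : ℝ³) 1, ‖u t x‖ₑ ^ 2 := by
          refine setLIntegral_congr_fun_ae measurableSet_ball ?_
          filter_upwards [ht'] with x hx hxB
          have e : uncurry u' (t, x) = uncurry u (t, x) := hx ⟨htI, hxB⟩
          simp only [uncurry] at e
          rw [e]
      _ ≤ C := ht
  · -- strong convergence to the modified limit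
    refine hstrong.congr fun j => lintegral_congr_ae ?_
    filter_upwards [hu'] with z hz
    have e : u' z.1 z.2 = u z.1 z.2 := hz
    rw [e]

end Literature.Analysis.FluidPDE

end
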